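import Literature.NumberTheory.Rogawski1990.ArchRealWallBlockPack              -- ★ p850918 (LH10-p02 (g5)) (G2-MUNFOLD-PACK): `exists_realWall_blockPack`, `chartTorusG_insert_le_centralizer_of_wall`
import Literature.NumberTheory.Rogawski1990.ArchOrbFamGExtRealWallContinuous   -- ★ p850625 (F0P3b-p01 (g15)) (I₂) real walls, order 0, binder form: `continuousOn_orbFamGExt_realWall_descended_of_cutoff`
import Literature.NumberTheory.Rogawski1990.ArchChartOrbGBlockCayRayBinders    -- ★ p850695 (F0P3-p02 (g18)): `gprimeTorus_insert_hcCayPt_eq`, `boostEig_cayRay_one_ne`; brings ★ SPLIT-DOCK p850470, ★ p850485 `integrable_descConj_gprimeTorus_of_regG`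
import Literature.NumberTheory.Automorphic.ArchRankOneSplitIwasawa             -- ★ (IWA) p850256 (this seat, g19): the circle `K₁`, `U(J) = K₁·B`, `isHaarMeasure_map_rotLift`; with ★ `exists_measure_quotient_torusU_complex_two_eq_smul_map`
import Literature.NumberTheory.Automorphic.ArchRankOneSplitOrbitChart          -- ★ FILE 1 (this seat, g19): `exists_measure_quotient_torusU_complex_two_eq_smul_map`, `modularCharacterFun_eq_one_of_eq_over_antidiagonal_two`, `forall_mem_torusU_comm`
import Literature.MeasureTheory.Group.ConjugationCutoff                        -- ★ Harish-Chandra's cut-off `exists_continuous_hasCompactSupport_integral_comp_mul_eq_one`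
import Literature.MeasureTheory.Group.InvariantQuotientAbelian                 -- ★ `isInvInvariant_of_comm`
import HarnessLib

/-!
# (I₂) AT THE REAL WALLS, ORDER 0 — HYPOTHESIS-FREE: the ordinary orbital family `orbFamGExt ν′ a′ (S ∪ {w₀})` of `G′_∞` is continuous at every
# semiregular point of the real wall `x_{w₀} = 0` (Harish-Chandra; Varadarajan 1989 §6.4 Thm 23; Rogawski 1990 §8.2 p. 119, §4.12; Shelstad 1979 §4 Lemma 4.3;
# Bouaziz 1994 §3.1 (I₂)) — the (B-INST) instantiation of ★ p850625 over the block pack ★ p850918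

Topic `NumberTheory/Rogawski1990`; namespace `Literature.NumberTheory.Rogawski1990`.  THEOREMS ONLY (no `def`, no instance, no notation, no axiom, no named fact, no `sorry`);
kernel lane `--kind proof --supports stmt-HodgeConjecture-24833`.  Cell `pub/hodgecm-mathlib`, crux H413 (`stmt-HodgeConjecture-24833`), F0∕P3c line LH3 (closer stub
`stub_N9`, N9″ DIRECT ROAD), letter L1 `HcOrbitalFamiliesStatement`, clause (I₂) «`orbFamGExt ν′ a′ S′` is `C^∞` on `InRegG s S′`» — part **(B-INST)** (LH3-plan (g3) 09:21:10Z
«= (B-INST)»; start condition ★ p850918 10:02:36Z): the binder-form head ★ `continuousOn_orbFamGExt_realWall_descended_of_cutoff` (F0P3b-p01 (g15), p850625) with EVERY binder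
discharged — `eM Ψ hΨ hγ ρ νM hmap` by ★ (G2-MUNFOLD-PACK) `exists_realWall_blockPack` (LH10-p02 (g5)), `hCM`∕`hint` on a BOX around the wall point by ★ SPLIT-DOCK
`uniformlyProper_gprimeTorus_of_semireg_split_of_regular` (the box twin of ★ `exists_isCompact_mul_centralizer_nhds_cayRay`, F0P3-p02 (g18)) and ★ `integrable_descConj_gprimeTorus_of_regG`
(F0P3a-p08), the cut-off `β` by ★ `exists_continuous_hasCompactSupport_integral_comp_mul_eq_one`, the Haar pair `(ρA, νU)` on `(A_J, U(J))` (`ρA` inversion invariant: ★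
`isInvInvariant_of_comm`; `νU` right invariant: `U(J)` unimodular, ★ `modularCharacterFun_eq_one_of_eq_over_antidiagonal_two`), and `hμC` for `μ := νU ∕ ρA` by ★ Iwasawa
`exists_measure_quotient_torusU_complex_two_eq_smul_map` along the circle `K₁` (★ `isCompact_range_rotLift`, ★ `exists_rotLift_mul_mem_borelU`, ★ `isHaarMeasure_map_rotLift`);
all σ-algebras Borel, chosen inside the proofs.

THE MATHEMATICS.  Let `S` be an admissible compact chart, `w₀ ∉ S` a split-chart place and `p` a SEMIREGULAR point of the noncompact wall `(w₀, 0, 2)` (`HcSemireg S w₀ 0 2 p`: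
`p_{w₀,0} = p_{w₀,2}`, the third eigenvalue at `w₀` distinct, regular at every other place).  In the split chart `S ∪ {w₀}` the same torus element is the point `hcCayPt w₀ 0 2 p` of the
REAL wall `x_{w₀} = 0` (★ `gprimeTorus_insert_hcCayPt_eq`), with centraliser `Z(γ_p) ≅ U(1,1) × K` (★ pack).  Harish-Chandra's compactness lemma holds UNIFORMLY on a compact box
around that point (§1: one compact `C″` with `y′ γ♯_c y′⁻¹ ∈ tsupport a′ ⇒ y′ ∈ C″ · Z(γ_p)` for all `c` in the box, and the chart integrand integrable off the wall), so ★ D4b's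
descent and ★ p850625's joint cone chart apply on the open box `U`: **`orbFamGExt L α ν′ a′ (S ∪ {w₀})` is continuous on `U ∩ InRegG (slotSign L α) (S ∪ {w₀})`**, in particular
continuous WITHIN `InRegG` AT the wall point — Harish-Chandra's continuity of `'F_f` across the real wall of the split Cartan, for the genuine family of `G′_∞`, with no hypothesis left.

* §1 `continuous_boostEig_apply`, `isOpen_pi_realWallBox`, `hcCayPt_mem_pi_realWallBox`, `mem_regG_insert_of_mem_pi_realWallBox`,
  **`exists_isCompact_mul_centralizer_nhds_hcCayPt`** (the BOX twin of ★ `hCMx`), **`exists_realWallBox_binders`** (`U`, `C″`, `hCM`, `hint` — the binders of ★ p850625 §3).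
* §2 **`exists_isOpen_continuousOn_orbFamGExt_realWall`** (HEAD: `∃ U` open `∋ hcCayPt w₀ 0 2 p`, `ContinuousOn (orbFamGExt …) (U ∩ InRegG …)`),
  **`continuousWithinAt_orbFamGExt_inRegG_hcCayPt`** (point form).
HONEST SCOPE: ORDER 0 (all orders = ★ p850781 `contDiffOn_orbFamGExt_realWall_of_block_of_smooth` over the same pack plus ONE smooth reading `Λ` of `b ↦ eM⁻¹(b,1)` that the pack
does not expose — ED. 2); ONE real wall at a time, at SEMIREGULAR points (corners `x_w = x_{w′} = 0` and real-wall × compact-wall points are other engines' business).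
HONEST LABEL: HC_CM is proved only modulo the 7 printed citations (2 remaining named inputs: hLiu418 = `stmt-HodgeConjecture-24832`, h413 = `stmt-HodgeConjecture-24833`) until rung 0
closes; count-neutral (a letter-L1 pay-down; no stub closes by this file alone).

## References
* [Varadarajan1989] V. S. Varadarajan, *An Introduction to Harmonic Analysis on Semisimple Lie Groups*, Cambridge Stud. Adv. Math. 16 (1989), §6.4 Lemma 21, Thm 23.
* [Rogawski1990] J. D. Rogawski, *Automorphic Representations of Unitary Groups in Three Variables*, Ann. of Math. Stud. 123 (1990), §4.12 Lemma 4.12.1 p. 66; §8.2 pp. 118–119, 122.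
* [Shelstad1979] D. Shelstad, *Characters and inner forms of a quasi-split group over ℝ*, Compositio Math. 39 (1979) 11–45, §4 p. 22, Lemma 4.3 (p. 25).
* [Bouaziz1994IntegralesOrbitales] A. Bouaziz, *Intégrales orbitales sur les groupes de Lie réductifs*, Ann. Sci. ÉNS 27 (1994), §3.1 (I₂) p. 579; §6.2 p. 591.
* [HarishChandra1970] Harish-Chandra, *Harmonic analysis on reductive p-adic groups* (notes by G. van Dijk), LNM 162 (1970), Part I §3 Lemmas 19, 22–23.
* [Folland1995] G. B. Folland, *A Course in Abstract Harmonic Analysis* (1995), §2.6 Thm. 2.49, (2.52).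
* [Borel1997] A. Borel, *Automorphic Forms on SL₂(ℝ)*, Cambridge Tracts in Math. 130 (1997), §2.5.
-/

set_option autoImplicit false

noncomputable section

open MeasureTheory MeasureTheory.Measure Set Filter Topology NumberField NumberField.InfinitePlace Complex
open Literature.MeasureTheory.Group Literature.NumberTheory.Automorphic Literature.NumberTheory.Automorphic.UnitaryGroup Literature.NumberTheory.Automorphic.ArchCartan
open scoped MatrixGroups Matrix Pointwise NNReal Classical

namespace Literature.NumberTheory.Rogawski1990

/-! ## §1 Harish-Chandra's compactness lemma on a BOX around a semiregular real-wall point -/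

section Box

variable {W : Type*} [Fintype W] [DecidableEq W] (S : Finset W) (w₀ : W)

/-- The three boost eigenvalues `e^{x+iθ}, e^{iφ}, e^{−x+iθ}` depend continuously on the coordinates `(x, φ, θ)`. [cite: Knapp1986, Ch. V §3] -/
theorem continuous_boostEig_apply (j : Fin 3) : Continuous fun cw : Fin 3 → ℝ => boostEig cw j := by
  fin_cases j
  · simp only [boostEig, Fin.zero_eta, Matrix.cons_val_zero]
    exact Complex.continuous_exp.comp ((Complex.continuous_ofReal.comp (continuous_apply 0)).add ((Complex.continuous_ofReal.comp (continuous_apply 2)).mul continuous_const))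
  · simp only [boostEig, Fin.mk_one, Matrix.cons_val_one, Matrix.cons_val_zero]
    exact Complex.continuous_exp.comp ((Complex.continuous_ofReal.comp (continuous_apply 1)).mul continuous_const)
  · simp only [boostEig, Fin.reduceFinMk, Matrix.cons_val_two, Matrix.tail_cons, Matrix.head_cons]
    exact Complex.continuous_exp.comp ((Complex.continuous_ofReal.comp (continuous_apply 0)).neg.add ((Complex.continuous_ofReal.comp (continuous_apply 2)).mul continuous_const))

/-- **The admissible box of the split chart `S ∪ {w₀}` near its real wall is OPEN**: at `w₀` the middle eigenvalue stays simple, at the compact places the three unit eigenvalues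
stay distinct, at the other split places `x_w ≠ 0`. [cite: Rogawski1990, §8.2 p. 118] [cite: Shelstad1979, §4 p. 22] -/
theorem isOpen_pi_realWallBox :
    IsOpen (Set.pi Set.univ (fun w : W => {cw : Fin 3 → ℝ |
        (w = w₀ → ∀ j : Fin 3, j ≠ 1 → boostEig cw 1 ≠ boostEig cw j) ∧
        (w ∉ insert w₀ S → Function.Injective fun l : Fin 3 => Circle.exp (cw l)) ∧ (w ≠ w₀ → w ∈ S → cw 0 ≠ 0)})) := by
  -- a constant premise in front of an open condition keeps it open
  have himp : ∀ (P : Prop) (Q : (Fin 3 → ℝ) → Prop), IsOpen {cw | Q cw} → IsOpen {cw | P → Q cw} := fun P Q hQ => by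
    by_cases hP : P
    · have h : {cw : Fin 3 → ℝ | P → Q cw} = {cw | Q cw} := Set.ext fun cw => ⟨fun h => h hP, fun h _ => h⟩
      rw [h]; exact hQ
    · have h : {cw : Fin 3 → ℝ | P → Q cw} = Set.univ := Set.eq_univ_of_forall fun cw h => absurd h hP
      rw [h]; exact isOpen_univ
  refine isOpen_set_pi Set.finite_univ fun w _ => ?_
  refine (himp _ _ ?_).and ((himp _ _ ?_).and (himp _ _ (himp _ _ (isOpen_ne_fun (continuous_apply 0) continuous_const))))
  · have h : {cw : Fin 3 → ℝ | ∀ j : Fin 3, j ≠ 1 → boostEig cw 1 ≠ boostEig cw j} =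
        {cw | boostEig cw 1 ≠ boostEig cw 0} ∩ {cw | boostEig cw 1 ≠ boostEig cw 2} := by
      ext cw
      simp only [Set.mem_setOf_eq, Set.mem_inter_iff]
      constructor
      · intro h; exact ⟨h 0 (by decide), h 2 (by decide)⟩
      · rintro ⟨h0, h2⟩ j hj
        fin_cases j
        · exact h0
        · exact absurd rfl hj
        · exact h2
    rw [h]
    exact (isOpen_ne_fun (continuous_boostEig_apply 1) (continuous_boostEig_apply 0)).inter
      (isOpen_ne_fun (continuous_boostEig_apply 1) (continuous_boostEig_apply 2))
  · -- distinct unit eigenvalues: a finite intersection of `≠`-conditions in the Hausdorff `Circle`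
    have h : {cw : Fin 3 → ℝ | Function.Injective fun l : Fin 3 => Circle.exp (cw l)} =
        ⋂ q ∈ {q : Fin 3 × Fin 3 | q.1 ≠ q.2}, {cw : Fin 3 → ℝ | Circle.exp (cw q.1) ≠ Circle.exp (cw q.2)} := by
      ext cw
      simp only [Set.mem_setOf_eq, Set.mem_iInter, Prod.forall]
      constructor
      · intro hc i j hij h
        exact hij (hc h)
      · intro hc i j h
        by_contra hij
        exact hc i j hij h
    rw [h]
    exact Set.Finite.isOpen_biInter (Set.toFinite _) fun q _ =>
      isOpen_ne_fun (Circle.exp.continuous.comp (continuous_apply q.1)) (Circle.exp.continuous.comp (continuous_apply q.2))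

omit [Fintype W] in
/-- **The real-wall point `hcCayPt w₀ 0 2 p` of a semiregular `p` lies in the admissible box.** [cite: Shelstad1979, §4 p. 22] [cite: Rogawski1990, §8.2 p. 118] -/
theorem hcCayPt_mem_pi_realWallBox {p : W → Fin 3 → ℝ} (hp : HcSemireg S w₀ 0 2 p) :
    hcCayPt w₀ 0 2 p ∈ Set.pi Set.univ (fun w : W => {cw : Fin 3 → ℝ |
        (w = w₀ → ∀ j : Fin 3, j ≠ 1 → boostEig cw 1 ≠ boostEig cw j) ∧
        (w ∉ insert w₀ S → Function.Injective fun l : Fin 3 => Circle.exp (cw l)) ∧ (w ≠ w₀ → w ∈ S → cw 0 ≠ 0)}) := by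
  intro w _
  refine ⟨fun hw => ?_, fun hwS => ?_, fun hww hwS => ?_⟩
  · rw [hw]
    have h := boostEig_cayRay_one_ne hp 0
    rwa [zero_smul, add_zero] at h
  · rw [Finset.mem_insert, not_or] at hwS
    rw [hcCayPt_apply_of_ne hwS.1]
    exact hp.2.2.1 w hwS.2 hwS.1
  · rw [hcCayPt_apply_of_ne hww]
    exact hp.2.2.2 w hwS

omit [Fintype W] in
/-- **Off the real wall, the admissible box is `G`-regular for the split chart `S ∪ {w₀}`.** [cite: Rogawski1990, §8.2 p. 118] [cite: Bouaziz1994IntegralesOrbitales, §3.1 p. 579] -/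
theorem mem_regG_insert_of_mem_pi_realWallBox {c : W → Fin 3 → ℝ}
    (hc : c ∈ Set.pi Set.univ (fun w : W => {cw : Fin 3 → ℝ |
        (w = w₀ → ∀ j : Fin 3, j ≠ 1 → boostEig cw 1 ≠ boostEig cw j) ∧
        (w ∉ insert w₀ S → Function.Injective fun l : Fin 3 => Circle.exp (cw l)) ∧ (w ≠ w₀ → w ∈ S → cw 0 ≠ 0)}))
    (hx : c w₀ 0 ≠ 0) : c ∈ RegG (insert w₀ S) := by
  refine ⟨fun w hw => (hc w (Set.mem_univ w)).2.1 hw, fun w hw => ?_⟩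
  rcases Finset.mem_insert.1 hw with h | h
  · rw [h]; exact hx
  · by_cases hww : w = w₀
    · rw [hww]; exact hx
    · exact (hc w (Set.mem_univ w)).2.2 hww h

end Box

/-! ## §1 (continued) One compact modulo `Z(γ_p)` for a whole box, and integrability off the wall -/

section Binders

variable (L : Type) [Field L] [NumberField L] [IsCMField L] (α : Fin 3 → L)
  (S : Finset {w : InfinitePlace L // IsComplex w}) (w₀ : {w : InfinitePlace L // IsComplex w}) (p : {w : InfinitePlace L // IsComplex w} → Fin 3 → ℝ)

/-- **HARISH-CHANDRA'S COMPACTNESS LEMMA ON A BOX AROUND THE REAL-WALL POINT, hypothesis-free** (the box twin of ★ `exists_isCompact_mul_centralizer_nhds_cayRay`): at a semiregular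
point `p` of the wall `(w₀, 0, 2)` of an admissible compact chart `S` (`w₀ ∉ S` a split-chart place), for every compact `C′ ⊆ G′_∞` there are ONE compact `C″` and an OPEN set
`U ∋ hcCayPt w₀ 0 2 p` inside the admissible box with `y′ · gprimeTorus (S ∪ {w₀}) c · y′⁻¹ ∈ C′ ⇒ y′ ∈ C″ · Z(γ_p)` for ALL `c ∈ U` (★ SPLIT-DOCK
`uniformlyProper_gprimeTorus_of_semireg_split_of_regular` on a compact neighbourhood of the Cayley point, whose centraliser is `Z(γ_p)` by ★ `gprimeTorus_insert_hcCayPt_eq`).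
[cite: Rogawski1990, §4.12 Lemma 4.12.1 p. 66; §8.2 pp. 114, 122] [cite: HarishChandra1970, Part I §3 Lemma 22] [cite: Shelstad1979, §4 p. 25] [cite: DeitmarEchterhoff2014, Remark 1.5.2] -/
theorem exists_isCompact_mul_centralizer_nhds_hcCayPt (hα : ∀ i, α i ≠ 0)
    (hS : ∀ w, w ∈ S → w ∈ splitChartPlaces L α) (hw₀ : w₀ ∉ S) (hsp : w₀ ∈ splitChartPlaces L α) (hp : HcSemireg S w₀ 0 2 p)
    {C' : Set ↥(arch (↥(maximalRealSubfield L)) L (IsCMField.complexConj L) 3 (Matrix.diagonal α))} (hC' : IsCompact C') :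
    ∃ C'' : Set ↥(arch (↥(maximalRealSubfield L)) L (IsCMField.complexConj L) 3 (Matrix.diagonal α)), IsCompact C'' ∧
      ∃ U : Set ({w : InfinitePlace L // IsComplex w} → Fin 3 → ℝ), IsOpen U ∧ hcCayPt w₀ 0 2 p ∈ U ∧
        U ⊆ Set.pi Set.univ (fun w : {w : InfinitePlace L // IsComplex w} => {cw : Fin 3 → ℝ |
          (w = w₀ → ∀ j : Fin 3, j ≠ 1 → boostEig cw 1 ≠ boostEig cw j) ∧
          (w ∉ insert w₀ S → Function.Injective fun l : Fin 3 => Circle.exp (cw l)) ∧ (w ≠ w₀ → w ∈ S → cw 0 ≠ 0)}) ∧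
        ∀ c ∈ U, ∀ y' : ↥(arch (↥(maximalRealSubfield L)) L (IsCMField.complexConj L) 3 (Matrix.diagonal α)),
          y' * gprimeTorus L α (insert w₀ S) c * y'⁻¹ ∈ C' →
            y' ∈ C'' * ((Subgroup.centralizer ({gprimeTorus L α S p} : Set ↥(arch (↥(maximalRealSubfield L)) L (IsCMField.complexConj L) 3 (Matrix.diagonal α)))) :
              Set ↥(arch (↥(maximalRealSubfield L)) L (IsCMField.complexConj L) 3 (Matrix.diagonal α))) := by
  have hS' : ∀ w, w ∈ insert w₀ S → w ∈ splitChartPlaces L α := fun w hw =>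
    (Finset.mem_insert.1 hw).elim (fun h => h ▸ hsp) (hS w)
  have hx0 : hcCayPt w₀ 0 2 p w₀ 0 = 0 := hcCayPt_apply_self_zero w₀ 0 2 p
  have hp' : ∀ w, w ≠ w₀ → w ∈ insert w₀ S ∧ w ∈ splitChartPlaces L α → hcCayPt w₀ 0 2 p w 0 ≠ 0 := fun w hw hws => by
    rw [hcCayPt_apply_of_ne hw]
    exact hp.2.2.2 w (Finset.mem_of_mem_insert_of_ne hws.1 hw)
  -- a compact neighbourhood of the Cayley point inside the (open) admissible box, and its interior `U`
  obtain ⟨K, hKn, hKS, hKc⟩ := local_compact_nhds ((isOpen_pi_realWallBox S w₀).mem_nhds (hcCayPt_mem_pi_realWallBox S w₀ hp))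
  obtain ⟨𝒦', h𝒦', hmem𝒦⟩ := uniformlyProper_gprimeTorus_of_semireg_split_of_regular L α (insert w₀ S) hα (hcCayPt w₀ 0 2 p) w₀ (Finset.mem_insert_self w₀ S) hsp hx0 hp'
    (fun w : {w : InfinitePlace L // IsComplex w} => {cw : Fin 3 → ℝ |
        (w = w₀ → ∀ j : Fin 3, j ≠ 1 → boostEig cw 1 ≠ boostEig cw j) ∧
        (w ∉ insert w₀ S → Function.Injective fun l : Fin 3 => Circle.exp (cw l)) ∧ (w ≠ w₀ → w ∈ S → cw 0 ≠ 0)})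
    (fun cw hcw => hcw.1 rfl) (fun w hws cw hcw => hcw.2.1 (fun hwS => hws ⟨hwS, hS' w hwS⟩)) (fun w hw hws cw hcw => hcw.2.2 hw (Finset.mem_of_mem_insert_of_ne hws.1 hw))
    K hKS hKc C' hC'
  obtain ⟨C'', hC'', hsub⟩ := exists_isCompact_image_mk_superset
    (Subgroup.centralizer ({gprimeTorus L α (insert w₀ S) (hcCayPt w₀ 0 2 p)} : Set ↥(arch (↥(maximalRealSubfield L)) L (IsCMField.complexConj L) 3 (Matrix.diagonal α)))) h𝒦'
  refine ⟨C'', hC'', interior K, isOpen_interior, mem_interior_iff_mem_nhds.2 hKn, interior_subset.trans hKS, ?_⟩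
  rw [← gprimeTorus_insert_hcCayPt_eq L α hw₀ hsp hp.1]
  intro c hc y' hy'
  obtain ⟨a, ha, hay⟩ := hsub (hmem𝒦 c (interior_subset hc) y' hy')
  rw [QuotientGroup.eq] at hay
  exact ⟨a, ha, a⁻¹ * y', hay, by group⟩

variable [MeasurableSpace ↥(arch (↥(maximalRealSubfield L)) L (IsCMField.complexConj L) 3 (Matrix.diagonal α))]
  [BorelSpace ↥(arch (↥(maximalRealSubfield L)) L (IsCMField.complexConj L) 3 (Matrix.diagonal α))]
  (ν' : Measure ↥(arch (↥(maximalRealSubfield L)) L (IsCMField.complexConj L) 3 (Matrix.diagonal α))) [ν'.IsHaarMeasure] [ν'.IsMulRightInvariant]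
  {a' : ↥(arch (↥(maximalRealSubfield L)) L (IsCMField.complexConj L) 3 (Matrix.diagonal α)) → ℂ}

/-- **THE TWO BINDERS `hCM` ∕ `hint` OF ★ `continuousOn_orbFamGExt_realWall_descended_of_cutoff` ON A BOX, hypothesis-free**: at a semiregular point `p` of the wall `(w₀, 0, 2)`
(`S` admissible, `w₀ ∉ S` a split-chart place) and for `a′ ∈ C_c(G′_∞)` there are an open `U ∋ hcCayPt w₀ 0 2 p`, `G`-regular off the real wall, and ONE compact `C″` with
(`hCM`) `y′ · gprimeTorus (S ∪ {w₀}) c · y′⁻¹ ∈ tsupport a′ ⇒ y′ ∈ C″ · Z(γ_p)` for all `c ∈ U` and (`hint`) the chart integrand of `chartOrbG` integrable at every `c ∈ U` off the wall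
(★ `integrable_descConj_gprimeTorus_of_regG`). [cite: Rogawski1990, §4.12 Lemma 4.12.1 p. 66; §8.2 p. 122; §4.3 p. 43] [cite: HarishChandra1970, Part I §3 Lemma 22]
[cite: DeitmarEchterhoff2014, Lemma 9.3.3] -/
theorem exists_realWallBox_binders (hα : ∀ i, α i ≠ 0) (hS : ∀ w, w ∈ S → w ∈ splitChartPlaces L α) (hw₀ : w₀ ∉ S) (hsp : w₀ ∈ splitChartPlaces L α)
    (hp : HcSemireg S w₀ 0 2 p) (ha'c : Continuous a') (ha's : HasCompactSupport a') :
    ∃ U : Set ({w : InfinitePlace L // IsComplex w} → Fin 3 → ℝ), IsOpen U ∧ hcCayPt w₀ 0 2 p ∈ U ∧ (∀ c ∈ U, c w₀ 0 ≠ 0 → c ∈ RegG (insert w₀ S)) ∧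
      ∃ C'' : Set ↥(arch (↥(maximalRealSubfield L)) L (IsCMField.complexConj L) 3 (Matrix.diagonal α)), IsCompact C'' ∧
        (∀ c ∈ U, ∀ y' : ↥(arch (↥(maximalRealSubfield L)) L (IsCMField.complexConj L) 3 (Matrix.diagonal α)),
          y' * gprimeTorus L α (insert w₀ S) c * y'⁻¹ ∈ tsupport a' →
            y' ∈ C'' * ((Subgroup.centralizer ({gprimeTorus L α S p} : Set ↥(arch (↥(maximalRealSubfield L)) L (IsCMField.complexConj L) 3 (Matrix.diagonal α)))) :
              Set ↥(arch (↥(maximalRealSubfield L)) L (IsCMField.complexConj L) 3 (Matrix.diagonal α)))) ∧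
        ∀ c ∈ U, c w₀ 0 ≠ 0 → Integrable (descConj (gprimeTorus L α (insert w₀ S) c) (chartTorusG L α (insert w₀ S)) (forall_mem_chartTorusG_comm L α (insert w₀ S) c) a')
          (chartQuotientMeasureG L α ν' (insert w₀ S)) := by
  have hS' : ∀ w, w ∈ insert w₀ S → w ∈ splitChartPlaces L α := fun w hw =>
    (Finset.mem_insert.1 hw).elim (fun h => h ▸ hsp) (hS w)
  obtain ⟨C'', hC'', U, hU, hpU, hUbox, hCM⟩ := exists_isCompact_mul_centralizer_nhds_hcCayPt L α S w₀ p hα hS hw₀ hsp hp ha's.isCompact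
  have hreg : ∀ c ∈ U, c w₀ 0 ≠ 0 → c ∈ RegG (insert w₀ S) := fun c hc hx => mem_regG_insert_of_mem_pi_realWallBox S w₀ (hUbox hc) hx
  refine ⟨U, hU, hpU, hreg, C'', hC'', hCM, fun c hc hx => ?_⟩
  letI : MeasurableSpace (↥(arch (↥(maximalRealSubfield L)) L (IsCMField.complexConj L) 3 (Matrix.diagonal α)) ⧸ chartTorusG L α (insert w₀ S)) := borel _
  haveI : BorelSpace (↥(arch (↥(maximalRealSubfield L)) L (IsCMField.complexConj L) 3 (Matrix.diagonal α)) ⧸ chartTorusG L α (insert w₀ S)) := ⟨rfl⟩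
  haveI := isMulLeftInvariant_chartHaarG L α (insert w₀ S)
  haveI := isFiniteMeasureOnCompacts_chartHaarG L α (insert w₀ S)
  haveI := isOpenPosMeasure_chartHaarG L α (insert w₀ S)
  haveI := isInvInvariant_chartHaarG L α (insert w₀ S)
  have hq : chartQuotientMeasureG L α ν' (insert w₀ S) =
      quotientMeasure (chartTorusG L α (insert w₀ S)) (chartHaarG L α (insert w₀ S)) (isClosed_chartTorusG L α (insert w₀ S)) ν' := rfl
  haveI : IsFiniteMeasureOnCompacts (chartQuotientMeasureG L α ν' (insert w₀ S)) := by rw [hq]; infer_instance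
  exact integrable_descConj_gprimeTorus_of_regG L α (insert w₀ S) hα hS' (hreg c hc hx) ha'c ha's _

end Binders

/-! ## §2 The head: (I₂) at order 0 across the real wall, hypothesis-free -/

section Head

variable (L : Type) [Field L] [NumberField L] [IsCMField L] (α : Fin 3 → L)
  [MeasurableSpace ↥(arch (↥(maximalRealSubfield L)) L (IsCMField.complexConj L) 3 (Matrix.diagonal α))]
  [BorelSpace ↥(arch (↥(maximalRealSubfield L)) L (IsCMField.complexConj L) 3 (Matrix.diagonal α))]
  (ν' : Measure ↥(arch (↥(maximalRealSubfield L)) L (IsCMField.complexConj L) 3 (Matrix.diagonal α))) [ν'.IsHaarMeasure] [ν'.IsMulRightInvariant]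
  (a' : ↥(arch (↥(maximalRealSubfield L)) L (IsCMField.complexConj L) 3 (Matrix.diagonal α)) → ℂ)
  (S : Finset {w : InfinitePlace L // IsComplex w}) (w₀ : {w : InfinitePlace L // IsComplex w}) (p : {w : InfinitePlace L // IsComplex w} → Fin 3 → ℝ)

/-- **(I₂) AT ORDER 0 ACROSS THE REAL WALL `x_{w₀} = 0` — HYPOTHESIS-FREE HEAD.**  `S` an admissible compact chart, `w₀ ∉ S` a split-chart place, `p` a semiregular point of the
noncompact wall `(w₀, 0, 2)` (`HcSemireg S w₀ 0 2 p`), `a′ ∈ C_c(G′_∞)`.  Then there is an open `U ∋ hcCayPt w₀ 0 2 p` (the same torus element, read on the real wall of the split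
chart `S ∪ {w₀}`) such that **`orbFamGExt L α ν′ a′ (S ∪ {w₀})` is continuous on `U ∩ InRegG (slotSign L α) (S ∪ {w₀})`** — Harish-Chandra's continuity of `'F_f` across the real
wall of the split Cartan of `G′_∞`: ★ `continuousOn_orbFamGExt_realWall_descended_of_cutoff` with its binders discharged by ★ (G2-MUNFOLD-PACK) `exists_realWall_blockPack`
(`eM Ψ hΨ hγ ρ νM hmap`), §1 (`U`, `C″`, `hCM`, `hint`), ★ `exists_continuous_hasCompactSupport_integral_comp_mul_eq_one` (`β`), the Haar pair on `(A_J, U(J))`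
(★ `isInvInvariant_of_comm`, ★ `modularCharacterFun_eq_one_of_eq_over_antidiagonal_two`) and ★ Iwasawa `exists_measure_quotient_torusU_complex_two_eq_smul_map` (`hμC`).
[cite: Varadarajan1989, §6.4 Thm 23] [cite: Rogawski1990, §8.2 pp. 118–119; §4.12 Lemma 4.12.1 p. 66] [cite: Shelstad1979, §4 Lemma 4.3 (p. 25)]
[cite: Bouaziz1994IntegralesOrbitales, §3.1 (I₂) p. 579] [cite: HarishChandra1970, Part I §3 Lemmas 19, 22–23] [cite: Folland1995, §2.6 Thm. 2.49] [cite: Borel1997, §2.5] -/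
theorem exists_isOpen_continuousOn_orbFamGExt_realWall (hα : ∀ i, α i ≠ 0) (hS : ∀ w, w ∈ S → w ∈ splitChartPlaces L α) (hw₀ : w₀ ∉ S) (hsp : w₀ ∈ splitChartPlaces L α)
    (hp : HcSemireg S w₀ 0 2 p) (ha'c : Continuous a') (ha's : HasCompactSupport a') :
    ∃ U : Set ({w : InfinitePlace L // IsComplex w} → Fin 3 → ℝ), IsOpen U ∧ hcCayPt w₀ 0 2 p ∈ U ∧
      ContinuousOn (orbFamGExt L α ν' a' (insert w₀ S)) (U ∩ InRegG (slotSign L α) (insert w₀ S)) := by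
  have hS' : ∀ w, w ∈ insert w₀ S → w ∈ splitChartPlaces L α := fun w hw =>
    (Finset.mem_insert.1 hw).elim (fun h => h ▸ hsp) (hS w)
  -- the four clauses of `HcSemireg` in the pack's spelling
  have hp02 : p w₀ 0 = p w₀ 2 := hp.1
  have h01 : Circle.exp (p w₀ 0) ≠ Circle.exp (p w₀ 1) := by
    have h := hp.2.1
    rw [hcThird_zero_two] at h
    exact h.symm
  have hreg : ∀ w, w ≠ w₀ → w ∉ S → Function.Injective fun i : Fin 3 => Circle.exp (p w i) := fun w hw hwS => hp.2.2.1 w hwS hw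
  have hregS : ∀ w, w ∈ S → p w 0 ≠ 0 := hp.2.2.2
  -- §1: the box `U`, the compact `C″`, `hCM`, `hint`
  obtain ⟨U, hU, hpU, -, C'', hC'', hCM, hint⟩ := exists_realWallBox_binders L α S w₀ p ν' hα hS hw₀ hsp hp ha'c ha's
  -- the block `U(J)`, `J` antidiagonal, with its Borel σ-algebras
  obtain ⟨J, hJ⟩ : ∃ J : Matrix (Fin 2) (Fin 2) ℂ, J = (StdForm.antidiagonal 2).over ℂ := ⟨_, rfl⟩
  letI : MeasurableSpace ↥(unitaryGroupOfForm (starRingEnd ℂ) J) := borel _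
  haveI : BorelSpace ↥(unitaryGroupOfForm (starRingEnd ℂ) J) := ⟨rfl⟩
  haveI : LocallyCompactSpace ↥(unitaryGroupOfForm (starRingEnd ℂ) J) := locallyCompactSpace_unitaryGroupOfForm_complex J
  haveI : SecondCountableTopology ↥(unitaryGroupOfForm (starRingEnd ℂ) J) := secondCountableTopology_unitaryGroupOfForm_complex J
  letI : MeasurableSpace (↥(unitaryGroupOfForm (starRingEnd ℂ) J) ⧸ torusU (starRingEnd ℂ) J) := borel _
  haveI : BorelSpace (↥(unitaryGroupOfForm (starRingEnd ℂ) J) ⧸ torusU (starRingEnd ℂ) J) := ⟨rfl⟩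
  -- `Z(γ_p)` and its quotient by `T♯`
  have hZc : IsClosed ((Subgroup.centralizer ({gprimeTorus L α S p} : Set ↥(arch (↥(maximalRealSubfield L)) L (IsCMField.complexConj L) 3 (Matrix.diagonal α)))) :
      Set ↥(arch (↥(maximalRealSubfield L)) L (IsCMField.complexConj L) 3 (Matrix.diagonal α))) := isClosed_centralizer_singleton_of_t2 _
  haveI : LocallyCompactSpace ↥(Subgroup.centralizer ({gprimeTorus L α S p} : Set ↥(arch (↥(maximalRealSubfield L)) L (IsCMField.complexConj L) 3 (Matrix.diagonal α)))) :=
    hZc.isClosedEmbedding_subtypeVal.locallyCompactSpace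
  haveI : SecondCountableTopology ↥(Subgroup.centralizer ({gprimeTorus L α S p} : Set ↥(arch (↥(maximalRealSubfield L)) L (IsCMField.complexConj L) 3 (Matrix.diagonal α)))) :=
    TopologicalSpace.Subtype.secondCountableTopology _
  haveI : BorelSpace ↥(Subgroup.centralizer ({gprimeTorus L α S p} : Set ↥(arch (↥(maximalRealSubfield L)) L (IsCMField.complexConj L) 3 (Matrix.diagonal α)))) := Subtype.borelSpace _
  letI : MeasurableSpace (↥(Subgroup.centralizer ({gprimeTorus L α S p} : Set ↥(arch (↥(maximalRealSubfield L)) L (IsCMField.complexConj L) 3 (Matrix.diagonal α)))) ⧸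
      (chartTorusG L α (insert w₀ S)).subgroupOf (Subgroup.centralizer ({gprimeTorus L α S p} : Set ↥(arch (↥(maximalRealSubfield L)) L (IsCMField.complexConj L) 3 (Matrix.diagonal α))))) := borel _
  haveI : BorelSpace (↥(Subgroup.centralizer ({gprimeTorus L α S p} : Set ↥(arch (↥(maximalRealSubfield L)) L (IsCMField.complexConj L) 3 (Matrix.diagonal α)))) ⧸
      (chartTorusG L α (insert w₀ S)).subgroupOf (Subgroup.centralizer ({gprimeTorus L α S p} : Set ↥(arch (↥(maximalRealSubfield L)) L (IsCMField.complexConj L) 3 (Matrix.diagonal α))))) := ⟨rfl⟩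
  -- ★ THE PACK: block splitting `eM`, `Ψ`, `hΨ`, the joint chart reading `hγ`, `ρ` continuous, a Haar measure `νM`, and `hmap` for every Haar pair
  obtain ⟨K, eM, Ψ, hKc, hKcomm, hΨ, hγ, hρc, -, ⟨νM, hνM1, hνM2, hνM3⟩, hmapAll⟩ :=
    exists_realWall_blockPack L α S w₀ p hα hS hw₀ hsp hp02 h01 hreg hregS hJ
  haveI := hνM1; haveI := hνM2; haveI := hνM3
  -- Harish-Chandra's cut-off `β` of unit `νM`-mass on `C″ · Z(γ_p)`
  obtain ⟨β, hβc, hβs, hβ0, hβ1⟩ := exists_continuous_hasCompactSupport_integral_comp_mul_eq_one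
    (Subgroup.centralizer ({gprimeTorus L α S p} : Set ↥(arch (↥(maximalRealSubfield L)) L (IsCMField.complexConj L) 3 (Matrix.diagonal α)))) hZc νM hC''
  -- the Haar pair on `(A_J, U(J))`: `ρA` inversion invariant (abelian), `νU` right invariant (unimodular)
  have hTUc : IsClosed ((torusU (starRingEnd ℂ) J : Subgroup ↥(unitaryGroupOfForm (starRingEnd ℂ) J)) : Set ↥(unitaryGroupOfForm (starRingEnd ℂ) J)) :=
    LineRing.isClosed_torusU_two _ _
  have hNc : IsClosed ((unipotentU (starRingEnd ℂ) J : Subgroup ↥(unitaryGroupOfForm (starRingEnd ℂ) J)) : Set ↥(unitaryGroupOfForm (starRingEnd ℂ) J)) :=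
    LineRing.isClosed_unipotentU _ _
  haveI : LocallyCompactSpace ↥(torusU (starRingEnd ℂ) J) := hTUc.isClosedEmbedding_subtypeVal.locallyCompactSpace
  haveI : SecondCountableTopology ↥(torusU (starRingEnd ℂ) J) := TopologicalSpace.Subtype.secondCountableTopology _
  haveI : BorelSpace ↥(torusU (starRingEnd ℂ) J) := Subtype.borelSpace _
  haveI : LocallyCompactSpace ↥(unipotentU (starRingEnd ℂ) J) := hNc.isClosedEmbedding_subtypeVal.locallyCompactSpace
  haveI : SecondCountableTopology ↥(unipotentU (starRingEnd ℂ) J) := TopologicalSpace.Subtype.secondCountableTopology _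
  haveI : BorelSpace ↥(unipotentU (starRingEnd ℂ) J) := Subtype.borelSpace _
  obtain ⟨ρA, hρA⟩ : ∃ ρA : Measure ↥(torusU (starRingEnd ℂ) J), ρA.IsHaarMeasure := ⟨Measure.haar, inferInstance⟩
  haveI := hρA
  haveI : ρA.IsInvInvariant := isInvInvariant_of_comm _ hTUc (fun x hx y hy => LineRing.forall_mem_torusU_comm (starRingEnd ℂ) J hy x hx) ρA
  obtain ⟨νU, hνU⟩ : ∃ νU : Measure ↥(unitaryGroupOfForm (starRingEnd ℂ) J), νU.IsHaarMeasure := ⟨Measure.haar, inferInstance⟩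
  haveI := hνU
  haveI : νU.IsMulRightInvariant := isMulRightInvariant_of_modularCharacterFun_eq_one (modularCharacterFun_eq_one_of_eq_over_antidiagonal_two hJ) νU
  -- `hmap` from the pack, for `μ := νU ∕ ρA`
  obtain ⟨κ, -, hmap⟩ := hmapAll νM ρA νU
  -- the Iwasawa form of `μ` along the circle `K₁` (`hμC`)
  haveI : SMulInvariantMeasure ↥(unitaryGroupOfForm (starRingEnd ℂ) J) (↥(unitaryGroupOfForm (starRingEnd ℂ) J) ⧸ torusU (starRingEnd ℂ) J)
      (quotientMeasure (torusU (starRingEnd ℂ) J) ρA (LineRing.isClosed_torusU_two (starRingEnd ℂ) J) νU) :=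
    smulInvariantMeasure_quotientMeasure _ _ _ _
  have hμ0 : quotientMeasure (torusU (starRingEnd ℂ) J) ρA (LineRing.isClosed_torusU_two (starRingEnd ℂ) J) νU ≠ 0 := quotientMeasure_ne_zero _ _ _ _
  haveI : Fact (0 < 2 * Real.pi) := ⟨Real.two_pi_pos⟩
  -- the circle `K₁ = {k_s}` as a subgroup of `U(J)`: compact, `U(J) = K₁ · B`, Haar measure `κK = (s ↦ k_s)_* ds`
  obtain ⟨K₁, hK₁def⟩ : ∃ K₁ : Subgroup ↥(unitaryGroupOfForm (starRingEnd ℂ) J), (K₁ : Set ↥(unitaryGroupOfForm (starRingEnd ℂ) J)) =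
      Set.range (fun s : AddCircle (2 * Real.pi) =>
        (⟨archPlaneLiftGL 1 (rotMat s) (det_rotMat s), archPlaneLiftGL_rotMat_mem hJ s⟩ : ↥(unitaryGroupOfForm (starRingEnd ℂ) J))) :=
    ⟨{ carrier := Set.range (fun s : AddCircle (2 * Real.pi) =>
          (⟨archPlaneLiftGL 1 (rotMat s) (det_rotMat s), archPlaneLiftGL_rotMat_mem hJ s⟩ : ↥(unitaryGroupOfForm (starRingEnd ℂ) J)))
       one_mem' := ⟨0, Subtype.ext archPlaneLiftGL_rotMat_zero⟩
       mul_mem' := by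
         rintro _ _ ⟨s, rfl⟩ ⟨t, rfl⟩
         exact ⟨s + t, Subtype.ext (archPlaneLiftGL_rotMat_add s t)⟩
       inv_mem' := by
         rintro _ ⟨s, rfl⟩
         exact ⟨-s, Subtype.ext (by rw [Subgroup.coe_inv]; exact archPlaneLiftGL_rotMat_neg s)⟩ }, rfl⟩
  have hKmem : ∀ s : AddCircle (2 * Real.pi),
      (⟨archPlaneLiftGL 1 (rotMat s) (det_rotMat s), archPlaneLiftGL_rotMat_mem hJ s⟩ : ↥(unitaryGroupOfForm (starRingEnd ℂ) J)) ∈ K₁ := fun s => by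
    rw [← SetLike.mem_coe, hK₁def]; exact ⟨s, rfl⟩
  have hKmem' : ∀ k ∈ K₁, ∃ s : AddCircle (2 * Real.pi),
      k = (⟨archPlaneLiftGL 1 (rotMat s) (det_rotMat s), archPlaneLiftGL_rotMat_mem hJ s⟩ : ↥(unitaryGroupOfForm (starRingEnd ℂ) J)) := fun k hk => by
    rw [← SetLike.mem_coe, hK₁def] at hk
    obtain ⟨s, hs⟩ := hk
    exact ⟨s, hs.symm⟩
  have hK₁ : IsCompact (K₁ : Set ↥(unitaryGroupOfForm (starRingEnd ℂ) J)) := by rw [hK₁def]; exact isCompact_range_rotLift hJ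
  have hKB : ∀ g : ↥(unitaryGroupOfForm (starRingEnd ℂ) J), ∃ k ∈ K₁, ∃ b ∈ borelU (starRingEnd ℂ) J, g = k * b := by
    intro g
    obtain ⟨s, b, hb, hg⟩ := exists_rotLift_mul_mem_borelU hJ g
    exact ⟨_, hKmem s, b, hb, hg⟩
  haveI : CompactSpace ↥K₁ := isCompact_iff_compactSpace.1 hK₁
  haveI : BorelSpace ↥K₁ := Subtype.borelSpace _
  haveI hκH := isHaarMeasure_map_rotLift hJ K₁ hKmem hKmem'
  obtain ⟨C, -, hμC⟩ := exists_measure_quotient_torusU_complex_two_eq_smul_map hJ hK₁ hKB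
    (Measure.map (fun s : AddCircle (2 * Real.pi) =>
      ((⟨⟨archPlaneLiftGL 1 (rotMat s) (det_rotMat s), archPlaneLiftGL_rotMat_mem hJ s⟩, hKmem s⟩ : ↥K₁))) (volume : Measure (AddCircle (2 * Real.pi))))
    ρA (Measure.haar : Measure ↥(unipotentU (starRingEnd ℂ) J)) (quotientMeasure (torusU (starRingEnd ℂ) J) ρA (LineRing.isClosed_torusU_two (starRingEnd ℂ) J) νU) hμ0
  -- ★ p850625's head with every binder discharged
  refine ⟨U, hU, hpU, ?_⟩
  exact continuousOn_orbFamGExt_realWall_descended_of_cutoff L α ν' a' S w₀ (gprimeTorus L α S p)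
    (chartTorusG_insert_le_centralizer_of_wall L α S hw₀ hsp hp02) hJ
    (Measure.map (fun s : AddCircle (2 * Real.pi) =>
      ((⟨⟨archPlaneLiftGL 1 (rotMat s) (det_rotMat s), archPlaneLiftGL_rotMat_mem hJ s⟩, hKmem s⟩ : ↥K₁))) (volume : Measure (AddCircle (2 * Real.pi))))
    (Measure.haar : Measure ↥(unipotentU (starRingEnd ℂ) J))
    (quotientMeasure (torusU (starRingEnd ℂ) J) ρA (LineRing.isClosed_torusU_two (starRingEnd ℂ) J) νU) eM Ψ hΨ
    (U := U) (ϑ := fun c => c w₀ 2)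
    (ρ := fun c => (eM ⟨gprimeTorus L α (insert w₀ S) c, chartTorusG_insert_le_centralizer_of_wall L α S hw₀ hsp hp02 (gprimeTorus_mem_chartTorusG L α (insert w₀ S) c)⟩).2)
    (fun c _ => hγ c (Set.mem_univ c)) hS' hK₁ hμC hU ((continuous_apply 2).comp (continuous_apply w₀)).continuousOn hρc.continuousOn νM ha'c ha's hβc hβs hβ0 hβ1
    (fun c hc _ => hCM c hc) hint hmap

/-- **POINT FORM**: at every semiregular point of the real wall `x_{w₀} = 0` of the split chart `S ∪ {w₀}`, `orbFamGExt L α ν′ a′ (S ∪ {w₀})` is continuous WITHIN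
`InRegG (slotSign L α) (S ∪ {w₀})` — Harish-Chandra's `'F_f` extends continuously across the real wall. [cite: Varadarajan1989, §6.4 Thm 23] [cite: Varadarajan1977, I §1.12]
[cite: Rogawski1990, §8.2 p. 119] [cite: Shelstad1979, §4 Lemma 4.3 (p. 25)] [cite: Bouaziz1994IntegralesOrbitales, §3.1 (I₂) p. 579] -/
theorem continuousWithinAt_orbFamGExt_inRegG_hcCayPt (hα : ∀ i, α i ≠ 0) (hS : ∀ w, w ∈ S → w ∈ splitChartPlaces L α) (hw₀ : w₀ ∉ S) (hsp : w₀ ∈ splitChartPlaces L α)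
    (hp : HcSemireg S w₀ 0 2 p) (ha'c : Continuous a') (ha's : HasCompactSupport a') :
    ContinuousWithinAt (orbFamGExt L α ν' a' (insert w₀ S)) (InRegG (slotSign L α) (insert w₀ S)) (hcCayPt w₀ 0 2 p) := by
  obtain ⟨U, hU, hpU, hcont⟩ := exists_isOpen_continuousOn_orbFamGExt_realWall L α ν' a' S w₀ p hα hS hw₀ hsp hp ha'c ha's
  have h := hcont.continuousWithinAt ⟨hpU, hcCayPt_mem_inRegG_insert (slotSign L α) hp⟩
  rw [Set.inter_comm] at h
  exact (continuousWithinAt_inter (hU.mem_nhds hpU)).1 h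

/-- **POINT FORM AT AN ARBITRARY SEMIREGULAR REAL-WALL POINT `c` of the split chart `S ∪ {w₀}`** (`x_{w₀}(c) = 0`, `e^{iφ(c)} ≠ e^{iθ(c)}` at `w₀`, regular at every other
place): `orbFamGExt L α ν′ a′ (S ∪ {w₀})` is continuous within `InRegG (slotSign L α) (S ∪ {w₀})` at `c` — `c` is the Cayley point `hcCayPt w₀ 0 2 p` of the compact-chart point
`p := update c w₀ (θ, φ, θ)`. [cite: Varadarajan1989, §6.4 Thm 23] [cite: Rogawski1990, §8.2 p. 119] [cite: Shelstad1979, §4 Lemma 4.3 (p. 25)] [cite: Bouaziz1994IntegralesOrbitales, §3.1 (I₂) p. 579] -/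
theorem continuousWithinAt_orbFamGExt_inRegG_of_realWall (hα : ∀ i, α i ≠ 0) (hS : ∀ w, w ∈ S → w ∈ splitChartPlaces L α) (hw₀ : w₀ ∉ S) (hsp : w₀ ∈ splitChartPlaces L α)
    {c : {w : InfinitePlace L // IsComplex w} → Fin 3 → ℝ} (hx : c w₀ 0 = 0) (h12 : Circle.exp (c w₀ 1) ≠ Circle.exp (c w₀ 2))
    (hreg : ∀ w, w ∉ S → w ≠ w₀ → Function.Injective fun l : Fin 3 => Circle.exp (c w l)) (hregS : ∀ w, w ∈ S → c w 0 ≠ 0)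
    (ha'c : Continuous a') (ha's : HasCompactSupport a') :
    ContinuousWithinAt (orbFamGExt L α ν' a' (insert w₀ S)) (InRegG (slotSign L α) (insert w₀ S)) c := by
  -- `c` is the Cayley point of the compact-chart wall point `p := update c w₀ (θ, φ, θ)`, which is semiregular
  have hp0 : Function.update c w₀ ![c w₀ 2, c w₀ 1, c w₀ 2] w₀ 0 = c w₀ 2 := by rw [Function.update_self]; rfl
  have hp1 : Function.update c w₀ ![c w₀ 2, c w₀ 1, c w₀ 2] w₀ 1 = c w₀ 1 := by rw [Function.update_self]; rfl
  have hp2 : Function.update c w₀ ![c w₀ 2, c w₀ 1, c w₀ 2] w₀ 2 = c w₀ 2 := by rw [Function.update_self]; rfl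
  have hp : HcSemireg S w₀ 0 2 (Function.update c w₀ ![c w₀ 2, c w₀ 1, c w₀ 2]) := by
    refine ⟨by rw [hp0, hp2], ?_, fun w hwS hw => ?_, fun w hwS => ?_⟩
    · rw [hcThird_zero_two, hp1, hp0]; exact h12
    · rw [Function.update_of_ne hw]; exact hreg w hwS hw
    · have hw : w ≠ w₀ := fun h => hw₀ (h ▸ hwS)
      rw [Function.update_of_ne hw]; exact hregS w hwS
  have hc : hcCayPt w₀ 0 2 (Function.update c w₀ ![c w₀ 2, c w₀ 1, c w₀ 2]) = c := by
    rw [hcCayPt_eq_of_wall (show Function.update c w₀ ![c w₀ 2, c w₀ 1, c w₀ 2] w₀ 0 = Function.update c w₀ ![c w₀ 2, c w₀ 1, c w₀ 2] w₀ 2 by rw [hp0, hp2]),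
      hcThird_zero_two, hp1, hp0, Function.update_idem]
    refine (Function.update_eq_self_iff).2 ?_
    funext l
    fin_cases l
    · exact hx.symm
    · rfl
    · rfl
  rw [← hc]
  exact continuousWithinAt_orbFamGExt_inRegG_hcCayPt L α ν' a' S w₀ _ hα hS hw₀ hsp hp ha'c ha's

end Head

end Literature.NumberTheory.Rogawski1990

end
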